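import Literature.AlgebraicGeometry.Frobenioids.PrimarySteps
import Literature.AlgebraicGeometry.Frobenioids.ElementaryIsomorphisms
import HarnessLib

/-!
# Frobenioids I, Proposition 4.1 (Primary Steps), part (iii): co-primary steps and their
# cartesian square — proofs over the Frobenioid axioms

Mochizuki, *The geometry of Frobenioids I: the general theory*, Kyushu J. Math. **62** (2008)
293–400, §4, Proposition 4.1 (iii) and its proof, kurims text pp. 75–77
[cite: MochizukiFrdI2008, Prop. 4.1 (iii) p.75]. Standing data: a Frobenioid `C → F_Φ` (`hF`) of
isotropic type; steps (here: pre-steps) `ε : E → F`, `ι : I → F`.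

> "(iii) `ε_*(Div(ε)), ι_*(Div(ι)) ∈ Φ(F)` … have disjoint supports if and only if every pre-step
> `ζ : Z → F` such that there exist pre-steps `ε', ι'` satisfying `ε = ζ ∘ ε'`, `ι = ζ ∘ ι'` is, in
> fact, an isomorphism. In this case, we shall say that `ε, ι` are *co-primary*. If `ε, ι` are
> co-primary, then there exists a cartesian diagram in the category of pre-steps
> `ε' : U → E`, `ι' : U → I`, `ε ∘ ε' = ι ∘ ι'` such that `ε_*(ε'_*(Div(ε'))) = ι_*(Div(ι))`,
> `ι_*(ι'_*(Div(ι'))) = ε_*(Div(ε))`; if `ε, ι` are primary, then so are `ε', ι'`."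

The printed proof (pp. 76–77) translates (iii) "by applying the second equivalence of categories of
Definition 1.3, (iii), (d), to the various pre-steps over `F`" into the language of the monoid
`Φ(F)`: co-primary ⟺ "every `x_ζ ∈ Φ(F)` such that `x_ζ ≤ x_ε`, `x_ζ ≤ x_ι` is, in fact, equal to
`0`", and obtains the cartesian square from "`x_ε + x_ι ≤ x_U` if and only if `x_ε ≤ x_U`,
`x_ι ≤ x_U`". This file PROVES exactly these two categorical steps over the Frobenioid axioms:
`isCoprimary_iff_forall_dvd` (the translation, an `iff`) and `exists_coprimary_square` (the square
with all printed properties, from the displayed monoid property of `x_ε, x_ι`, taken as the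
hypothesis `hsum`). The remaining purely monoid-theoretic inputs ("disjoint supports" ⟺ no common
non-zero lower bound ⟹ the displayed property, for `Φ` perf-factorial, Def. 2.4 (i)(c)(d)) belong
to the perf-factorial monoid theory (seat abc-iut-L1-t2) and are not restated here; with them these
theorems yield `PreFrobenioidData.Prop41iii_criterion/_square` as typed (seat abc-iut-L1-t3).
Dictionary: `x_ψ := (ψ^*)⁻¹(Div ψ)` is `invDiv F ψ _`; monoids are multiplicative; composition is
diagrammatic. No new definitions.
-/

namespace Literature.AlgebraicGeometry.Frobenioids

open CategoryTheory Opposite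

universe w v v' u u'

/-! ### A monoid lemma: primality is invariant under isomorphisms of monoids (§0 p. 12) -/

/-- `IsPrimary` is transported along multiplicative equivalences (immediate from the definition,
§0 p. 12, since `≼` is preserved by homomorphisms). [cite: MochizukiFrdI2008, §0 p.12] -/
theorem isPrimary_map_mulEquiv_iff {M N : Type w} [CommMonoid M] [CommMonoid N] (e : M ≃* N)
    (a : M) : IsPrimary (e a) ↔ IsPrimary a := by
  constructor
  · rintro ⟨h1, h2⟩
    refine ⟨fun ha => h1 (by rw [ha, map_one]), fun b hb hba => ?_⟩
    have h := h2 (e b) (fun hb' => hb (by simpa using hb')) (Precsim.map e.toMonoidHom hba)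
    simpa using Precsim.map e.symm.toMonoidHom h
  · rintro ⟨h1, h2⟩
    refine ⟨fun ha => h1 (by simpa using ha), fun b hb hba => ?_⟩
    have h := h2 (e.symm b) (fun hb' => hb (by simpa using hb'))
      (by simpa using Precsim.map e.symm.toMonoidHom hba)
    simpa using Precsim.map e.toMonoidHom h

namespace PreFrobenioid

variable {D : Type u} [Category.{v} D] {Φ : Dᵒᵖ ⥤ CommMonCat.{w}}
  {C : Type u'} [Category.{v'} C] {F : C ⥤ ElemFrobenioid Φ}

/-! ### Pull-back along isomorphisms of `D` -/

/-- Pull-back along an isomorphism `g` of `D` as a multiplicative equivalence (inverse: pull-back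
along `g⁻¹`). [cite: MochizukiFrdI2008, Def. 1.1(ii) p.19] -/
theorem exists_mulEquiv_pull {X Y : D} (g : X ⟶ Y) [IsIso g] :
    ∃ e : Φ.obj (op Y) ≃* Φ.obj (op X), ∀ y, e y = pull Φ g y :=
  ⟨MulEquiv.ofBijective (pull Φ g) ⟨pull_injective_of_isIso Φ g, fun x =>
    ⟨pull Φ (inv g) x, by rw [← pull_comp, IsIso.hom_inv_id, pull_id]⟩⟩, fun _ => rfl⟩

/-- `IsPrimary` is invariant under pull-back along an isomorphism of `D`.
[cite: MochizukiFrdI2008, §0 p.12] -/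
theorem isPrimary_pull_iff {X Y : D} (g : X ⟶ Y) [IsIso g] (y : Φ.obj (op Y)) :
    IsPrimary (pull Φ g y) ↔ IsPrimary y := by
  obtain ⟨e, he⟩ := exists_mulEquiv_pull (Φ := Φ) g
  rw [← he]
  exact isPrimary_map_mulEquiv_iff e y

/-! ### The dictionary `ψ ↦ x_ψ = (ψ^*)⁻¹(Div ψ)` of Def. 1.3 (iii)(d) -/

/-- `Base(g ∘ ψ)^* x_ψ = g^* Div(ψ)` for a base-isomorphism `ψ`.
[cite: MochizukiFrdI2008, Def. 1.3(iii) p.25] -/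
theorem pull_base_comp_invDiv {Z Y A : C} (g : Z ⟶ Y) (ψ : Y ⟶ A) (h : IsBaseIso F ψ) :
    pull Φ (Base F (g ≫ ψ)) (invDiv F ψ h) = pull Φ (Base F g) (Div F ψ) := by
  rw [base_comp, pull_comp, pull_invDiv]

/-- `x_ψ ≤ x_{ψ ∘ g}` in `Φ(A)`: for a base-isomorphism `g : Z → Y` and a pre-step `ψ : Y → A`.
[cite: MochizukiFrdI2008, Def. 1.3(iii) p.25] -/
theorem invDiv_dvd_invDiv_comp {Z Y A : C} (g : Z ⟶ Y) (ψ : Y ⟶ A)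
    (hψ : IsPreStep F ψ) (h : IsBaseIso F (g ≫ ψ)) :
    invDiv F ψ hψ.2 ∣ invDiv F (g ≫ ψ) h := by
  haveI : IsIso (Base F (g ≫ ψ)) := h
  -- divisibility is reflected by the isomorphism `Base(ψ ∘ g)^*` (cf. `RatFrac.dvd_of_pull_dvd`)
  obtain ⟨e, he⟩ := exists_mulEquiv_pull (Φ := Φ) (Base F (g ≫ ψ))
  have h' : e (invDiv F ψ hψ.2) ∣ e (invDiv F (g ≫ ψ) h) := by
    rw [he, he, pull_invDiv, pull_base_comp_invDiv, div_comp_of_isLinear g hψ.1]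
    exact Dvd.intro _ rfl
  simpa using map_dvd e.symm.toMonoidHom h'

/-- An isomorphism has `x_ψ = 0`. [cite: MochizukiFrdI2008, Def. 1.3(iii) p.25] -/
theorem invDiv_eq_one_of_isIso (hP : IsPreFrobenioid Φ F) {Y A : C} (ψ : Y ⟶ A)
    (h : IsBaseIso F ψ) [IsIso ψ] : invDiv F ψ h = 1 := by
  unfold invDiv
  rw [show Div F ψ = 1 from isIsometry_of_isIso F hP ψ, map_one]

/-- In a Frobenioid of isotropic type a pre-step with `x_ψ = 0` is an isomorphism.
[cite: MochizukiFrdI2008, Def. 1.2(iv) p.23] -/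
theorem isIso_of_invDiv_eq_one (histr : IsOfIsotropicType F) {Y A : C} (ψ : Y ⟶ A)
    (hψ : IsPreStep F ψ) (h1 : invDiv F ψ hψ.2 = 1) : IsIso ψ :=
  histr Y ψ (by have h := pull_invDiv ψ hψ.2; rw [h1, map_one] at h; exact h.symm) hψ

/-! ### Proposition 4.1 (iii): co-primary steps -/

/-- **Proposition 4.1 (iii)**, the translation (FrdI p. 76): for pre-steps `ε : E → F`, `ι : I → F`
of a Frobenioid of isotropic type, "`ε, ι` are co-primary" [every pre-step `ζ : Z → F` through which
both factor by pre-steps is an isomorphism] iff "every `x_ζ ∈ Φ(F)` such that `x_ζ ≤ x_ε`,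
`x_ζ ≤ x_ι` is, in fact, equal to `0`" (Def. 1.3 (iii)(d), slice over `F`).
[cite: MochizukiFrdI2008, Prop. 4.1 (iii) p.75] -/
theorem isCoprimary_iff_forall_dvd (hF : IsFrobenioid F) (histr : IsOfIsotropicType F)
    {E I F' : C} {ε : E ⟶ F'} {ι : I ⟶ F'} (hε : IsPreStep F ε) (hι : IsPreStep F ι) :
    (∀ ⦃Z : C⦄ (ζ : Z ⟶ F'), IsPreStep F ζ →
        (∃ (ε' : E ⟶ Z) (ι' : I ⟶ Z), IsPreStep F ε' ∧ IsPreStep F ι' ∧ ε' ≫ ζ = ε ∧ ι' ≫ ζ = ι) →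
          IsIso ζ) ↔
      ∀ x : Φ.obj (op (baseObj F F')), x ∣ invDiv F ε hε.2 → x ∣ invDiv F ι hι.2 → x = 1 := by
  have hP := hF.isPreFrobenioid
  have hco : ∀ {X Y : C} (f : X ⟶ Y), IsCoAngular F f :=
    fun f => isCoAngular_of_isIsotropic_codomains F f fun Z _ => histr Z
  constructor
  · intro hcop x hxε hxι
    obtain ⟨Z, ζ, hζco, hζx⟩ := hF.iii_d_over_surj F' x
    obtain ⟨ε', hε'co, hε'⟩ := hF.iii_d_over_full ε ζ ⟨hco ε, hε⟩ hζco (hζx.symm ▸ hxε)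
    obtain ⟨ι', hι'co, hι'⟩ := hF.iii_d_over_full ι ζ ⟨hco ι, hι⟩ hζco (hζx.symm ▸ hxι)
    haveI : IsIso ζ := hcop ζ hζco.2 ⟨ε', ι', hε'co.2, hι'co.2, hε', hι'⟩
    rw [← hζx]
    exact invDiv_eq_one_of_isIso hP ζ hζco.2.2
  · rintro hmon Z ζ hζ ⟨ε', ι', hε', hι', h1, h2⟩
    subst h1 h2
    exact isIso_of_invDiv_eq_one histr ζ hζ
      (hmon _ (invDiv_dvd_invDiv_comp ε' ζ hζ hε.2) (invDiv_dvd_invDiv_comp ι' ζ hζ hι.2))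

/-- **Proposition 4.1 (iii)**, the cartesian square (FrdI pp. 75–77): if `x_ε + x_ι ≤ x_U` holds as
soon as `x_ε ≤ x_U` and `x_ι ≤ x_U` (the displayed monoid property, p. 77; for `Φ` perf-factorial it
holds when `ε, ι` are co-primary), then there are pre-steps `ε' : U → E`, `ι' : U → I` with
`ε ∘ ε' = ι ∘ ι'`, cartesian in the category of pre-steps, with `ε_*(ε'_*(Div ε')) = ι_*(Div ι)`
and `ι_*(ι'_*(Div ι')) = ε_*(Div ε)` [rendered as in the statement file: for the `y_ι` with
`Base(ι)^* y_ι = Div ι`, `Base(ε ∘ ε')^* y_ι = Div ε'`, and symmetrically]; and if `ε, ι` are primary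
then so are `ε', ι'` (`U → F` realises `x_ε + x_ι`, Def. 1.3 (iii)(d)).
[cite: MochizukiFrdI2008, Prop. 4.1 (iii) p.75] -/
theorem exists_coprimary_square (hF : IsFrobenioid F) (histr : IsOfIsotropicType F)
    {E I F' : C} {ε : E ⟶ F'} {ι : I ⟶ F'} (hε : IsPreStep F ε) (hι : IsPreStep F ι)
    (hsum : ∀ c : Φ.obj (op (baseObj F F')),
      invDiv F ε hε.2 ∣ c → invDiv F ι hι.2 ∣ c → invDiv F ε hε.2 * invDiv F ι hι.2 ∣ c) :
    ∃ (U : C) (ε' : U ⟶ E) (ι' : U ⟶ I), IsPreStep F ε' ∧ IsPreStep F ι' ∧ ε' ≫ ε = ι' ≫ ι ∧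
      (∀ ⦃V : C⦄ (a : V ⟶ E) (b : V ⟶ I), IsPreStep F a → IsPreStep F b → a ≫ ε = b ≫ ι →
          ∃! u : V ⟶ U, u ≫ ε' = a ∧ u ≫ ι' = b) ∧
      (∀ yι : Φ.obj (op (baseObj F F')), pull Φ (Base F ι) yι = Div F ι →
          pull Φ (Base F (ε' ≫ ε)) yι = Div F ε') ∧
      (∀ yε : Φ.obj (op (baseObj F F')), pull Φ (Base F ε) yε = Div F ε →
          pull Φ (Base F (ι' ≫ ι)) yε = Div F ι') ∧
      (IsPrimaryPreStep F ε → IsPrimaryPreStep F ι → IsPrimaryPreStep F ε' ∧ IsPrimaryPreStep F ι') := by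
  have hP := hF.isPreFrobenioid
  have hco : ∀ {X Y : C} (f : X ⟶ Y), IsCoAngular F f :=
    fun f => isCoAngular_of_isIsotropic_codomains F f fun Z _ => histr Z
  haveI : IsIso (Base F ε) := hε.2
  haveI : IsIso (Base F ι) := hι.2
  -- `υ : U → F` realising `x_ε + x_ι`; `ε'`, `ι'` by fullness of the slice equivalence
  obtain ⟨U, υ, hυco, hυx⟩ := hF.iii_d_over_surj F' (invDiv F ε hε.2 * invDiv F ι hι.2)
  haveI : IsIso (Base F υ) := hυco.2.2
  haveI : IsCancelMul (Φ.obj (op (baseObj F U))) :=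
    isIntegral_iff_isCancelMul.mp (hP.isDivisorial (baseObj F U)).isPreDivisorial.isIntegral
  obtain ⟨ε', hε'co, hε'⟩ := hF.iii_d_over_full υ ε hυco ⟨hco ε, hε⟩
    (by rw [hυx]; exact Dvd.intro _ rfl)
  obtain ⟨ι', hι'co, hι'⟩ := hF.iii_d_over_full υ ι hυco ⟨hco ι, hι⟩
    (by rw [hυx]; exact Dvd.intro_left _ rfl)
  -- `Div υ = υ^* x_ε + υ^* x_ι`, and `Div υ = ε'^* Div ε + Div ε' = υ^* x_ε + Div ε'` (same for `ι'`)
  have hDυ : Div F υ = pull Φ (Base F υ) (invDiv F ε hε.2) * pull Φ (Base F υ) (invDiv F ι hι.2) := by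
    rw [← map_mul, ← hυx, pull_invDiv]
  have hDε' : Div F ε' = pull Φ (Base F υ) (invDiv F ι hι.2) := by
    have h : Div F υ = pull Φ (Base F υ) (invDiv F ε hε.2) * Div F ε' := by
      rw [← hε', div_comp_of_isLinear ε' hε.1, pull_base_comp_invDiv]
    rw [hDυ] at h
    exact (mul_left_cancel h).symm
  have hDι' : Div F ι' = pull Φ (Base F υ) (invDiv F ε hε.2) := by
    have h : Div F υ = pull Φ (Base F υ) (invDiv F ι hι.2) * Div F ι' := by
      rw [← hι', div_comp_of_isLinear ι' hι.1, pull_base_comp_invDiv]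
    rw [hDυ, mul_comm] at h
    exact (mul_left_cancel h).symm
  refine ⟨U, ε', ι', hε'co.2, hι'co.2, by rw [hε', hι'], ?_, ?_, ?_, ?_⟩
  · -- cartesian among pre-steps
    intro V a b ha hb hab
    have hw : IsPreStep F (a ≫ ε) := IsPreStep.comp F ha hε
    have hdε : invDiv F ε hε.2 ∣ invDiv F (a ≫ ε) hw.2 := invDiv_dvd_invDiv_comp a ε hε hw.2
    have hdι : invDiv F ι hι.2 ∣ invDiv F (a ≫ ε) hw.2 := by
      have key : ∀ {χ : V ⟶ F'} (hχ : IsBaseIso F χ), χ = b ≫ ι →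
          invDiv F ι hι.2 ∣ invDiv F χ hχ := by
        rintro χ hχ rfl
        exact invDiv_dvd_invDiv_comp b ι hι hχ
      exact key hw.2 hab
    obtain ⟨u, -, hu⟩ := hF.iii_d_over_full (a ≫ ε) υ ⟨hco _, hw⟩ hυco
      (by rw [hυx]; exact hsum _ hdε hdι)
    haveI := hF.v_a ε hε
    haveI := hF.v_a ι hι
    haveI := hF.v_a ε' hε'co.2
    have hua : u ≫ ε' = a := by
      apply (cancel_mono ε).mp
      rw [Category.assoc, hε', hu]
    have hub : u ≫ ι' = b := by
      apply (cancel_mono ι).mp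
      rw [Category.assoc, hι', hu, hab]
    refine ⟨u, ⟨hua, hub⟩, fun u' hu' => ?_⟩
    apply (cancel_mono ε').mp
    rw [hu'.1, hua]
  · -- `ε_*(ε'_*(Div ε')) = ι_*(Div ι)`
    intro yι hyι
    have hy : yι = invDiv F ι hι.2 :=
      pull_injective_of_isIso Φ (Base F ι) (by rw [hyι, pull_invDiv])
    rw [hy, hε', hDε']
  · -- `ι_*(ι'_*(Div ι')) = ε_*(Div ε)`
    intro yε hyε
    have hy : yε = invDiv F ε hε.2 :=
      pull_injective_of_isIso Φ (Base F ε) (by rw [hyε, pull_invDiv])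
    rw [hy, hι', hDι']
  · -- primary ⇒ primary (`Div ε'` is the transport of `Div ι` along base isomorphisms, and vice versa)
    rintro ⟨-, hpε⟩ ⟨-, hpι⟩
    refine ⟨⟨hε'co.2, ?_⟩, ⟨hι'co.2, ?_⟩⟩
    · rw [hDε']
      unfold invDiv
      rw [← pull_comp]
      exact (isPrimary_pull_iff _ _).mpr hpι
    · rw [hDι']
      unfold invDiv
      rw [← pull_comp]
      exact (isPrimary_pull_iff _ _).mpr hpε

end PreFrobenioid

end Literature.AlgebraicGeometry.Frobenioids
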